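import Literature.Probability.Percolation.CerfTwoArms
import Mathlib.MeasureTheory.Integral.Bochner.Basic
import HarnessLib

/-!
# Cerf 2015, §§3–9: the objects and intermediate results behind Theorem 1.1

Topic `Literature/Probability/Percolation`. Second decomposition file (after `CerfTwoArms.lean`)
for R. Cerf, *A lower bound on the two-arms exponent for critical percolation on the lattice*,
Ann. Probab. 43 (2015) 2458–2480, doi:10.1214/14-AOP940 (arXiv:1306.3105; page numbers refer
to the 16-page arXiv rendering). It serves the discharge of the named fact
`Literature.Probability.Percolation.Cerf2015_thm_1_1_of_siteTheta_pos` (Theorem 1.1 at a parameter `p` with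
`θ(p) > 0`, the last input of Theorem 1.3 = `Cerf2015_thm_1_3`, cf. `CerfLem71Proofs.lean`),
whose printed proof is §§3–9: the Aizenman–Kesten–Newman / Gandolfi–Grimmett–Russo counting
argument (§3), the large deviation estimate for the statistic `h` of an explored cluster
(Prop. 4.1, Hoeffding), the central inequality (Lemma 5.1), the connection lower bound
(Lemma 6.1), the box two-arms bound (Cor. 7.2, from Lemma 7.1 = `Cerf2015_lem_7_1_holds`), the
covering argument of §8 and the exponent iteration of §9.

This file defines Cerf's statistic `h`, the trace `C̄(x) ∩ Λ` of the closure of a restricted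
open cluster, and the collection `𝒞` of large clusters, and vendors the intermediate results as
named facts (`def … : Prop`, D-0014) in the precise form in which the printed proofs establish
them and in which they are used downstream. They are discharged bottom-up in sibling
`…Proofs.lean` files.

## Definitions (site percolation on a graph `G`; on `ℤ^d`: `zdGraph d`, `Λ(n) = box d n`)

* `cerfH p ω A = (1/(1−p)) #{x ∈ A closed} − (1/p) #{x ∈ A open}` (p. 6);
* `clusterClosureIn G L Λ ω x = C̄ ∩ Λ` where `C = C_L(x)` is the open cluster of `x` in the
  configuration restricted to `L` and `C̄ = C ∪ ∂ᵒᵘᵗ C` (pp. 6–7);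
* `reachingClusters G L Λ ω` = the collection of the open clusters of the configuration
  restricted to `L` which meet `Λ` and `∂ⁱⁿ L`, as finite sets (p. 5, the collection `𝒞`, see
  the repair below).

## Faithfulness notes (read before discharging)

* **The collection `𝒞` (§3, p. 5–6).** Cerf takes `𝒞` = clusters of `Λ(n+ℓ)` meeting `Λ(n)`
  and `∂ⁱⁿΛ(n+ℓ)` and claims (p. 9) "if `x ∈ Λ(n)` and `two-arms(x, 2n+ℓ)` occurs, then `x ∈ H`",
  `H = ⋃_{C₁ ≠ C₂ ∈ 𝒞} ∂ᵒᵘᵗC₁ ∩ ∂ᵒᵘᵗC₂ ∩ Λ(n)`. For `x ∈ ∂ⁱⁿΛ(n)` this fails as printed: the two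
  arms start at neighbours of `x`, which may lie in `Λ(n+1) ∖ Λ(n)`, and their clusters need not
  meet `Λ(n)`. The argument is repaired verbatim by letting `𝒞` consist of the clusters meeting
  `Λ(n+1)` (and `∂ⁱⁿΛ(n+ℓ)`), for `ℓ ≥ 2`; the sets `F, G, H ⊆ Λ(n)` and all of §3, §5, §8 are
  unchanged (in §5 the union bound for `P(ℰᶜ)` then runs over `x ∈ Λ(n+1)`, giving the factor
  `|Λ(n+1)| |Λ(n)|` in place of `|Λ(n)|²`; in §8 one covers `∂ⁱⁿΛ(n+1)`). The facts below are
  stated for this repaired `𝒞 = reachingClusters G Λ(n+ℓ) Λ(n+1)`.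
* **Prop. 4.1.** The displayed statement omits the factor `2` of the two-sided Hoeffding bound
  which its proof (p. 7, last display: "`≤ 2 exp(−(2/k) t² p² (1−p)²)`") and its use in §5
  produce; we vendor the proved bound `2 exp(−2p²(1−p)² t²/k)`.
* **Lemma 5.1** is vendored with the second term `(4d/(p(1−p))) |Λ(n+1)|² exp(−2 (ln n)² p²(1−p)²)`
  (print: `|Λ(n)|²`), see the first item, and for `ℓ ≥ 2`.
* **Lemma 6.1 at `p` with `θ(p) > 0`.** Lemma 6.1 is printed at `p_c` with a constant depending
  on `d` only, resting on `Σ_{x ∈ ∂ⁱⁿΛ} P_{p_c}(0 ⟷ x in Λ) ≥ 1` (Hammersley / Kozma–Nachmias).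
  §10 (p. 15) runs the whole of §§3–9 at a parameter `p` with `θ(p) > 0`, where the input is
  replaced by `P_p(0 ⟷ x_n in Λ(n)) ≥ θ(p)/|∂ⁱⁿΛ(n)|` (p. 15, from `θ(p) ≤ P(0 ⟷ ∂ⁱⁿΛ(n))`); the
  rest of the proof of Lemma 6.1 (FKG, symmetry, the chain `z_0, …, z_d`) is unchanged and gives
  the same polynomial order `n^{−2(d−1)d}` with a constant depending on `d` and `θ(p)`. This used
  form is `Cerf2015_lem_6_1_of_siteTheta_pos` (companion of `Cerf2015_thm_1_1_of_siteTheta_pos`).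
* **The recursion of §8–§9.** The last display of §8 / first display of §9 (p. 13 bottom, p. 14
  top), "`P(two-arms(0,3n)) ≤ (c ln n/√n) (k^{−(d−1)} + k^{2d²+2d−2} P(two-arms(0,n−k)))^{1/2}`
  for `1 ≤ k ≤ n`", silently absorbs the super-polynomially small second term of Lemma 5.1 into
  the constant, which requires `ln n > 0`, i.e. `n ≥ 2` (at `n = 1` the display is false), and
  is obtained through Cor. 7.2, whose proved form has `two-arms(0, ℓ−n−1)` (`CerfTwoArms.lean`,
  module docstring); with the repaired `𝒞` (boxes of the covering inside `Λ(n+1)`, so `ℓ = n−1`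
  in Cor. 7.2) the radius becomes `n−k−2` and the range `k + 3 ≤ n`. Since
  `m ↦ two-arms(0, m)` is decreasing, the vendored `Cerf2015_sec9_recursion` is implied by the
  printed display and is what the printed argument proves; it is all that §9 uses.

Nothing here is in Mathlib (`lean search 'two.?arms|Hoeffding.*explor|lattice animal'`).
-/

noncomputable section

open MeasureTheory Filter Topology Literature.Probability.LatticeModels Literature.Probability.Percolation

namespace Literature.Probability.Percolation

section CritPerc

variable {V : Type*} {d : ℕ}

/-! ### Cerf's statistic `h`, closures of restricted clusters, the collection `𝒞` -/

open Classical in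
/-- **Cerf's statistic** `h(A) = (1/(1−p)) |{x ∈ A : x closed}| − (1/p) |{x ∈ A : x open}|`
for a finite set of sites `A` in the configuration `ω` (Cerf 2015, §3, p. 6).
[cite: Cerf2015, §3] -/
def cerfH (p : ℝ) (ω : SiteConfig V) (A : Finset V) : ℝ :=
  1 / (1 - p) * ((A.filter fun x => x ∉ ω).card : ℝ) - 1 / p * ((A.filter fun x => x ∈ ω).card : ℝ)

/-- `h(∅) = 0`. [cite: Cerf2015, §3] -/
@[simp] theorem cerfH_empty (p : ℝ) (ω : SiteConfig V) : cerfH p ω ∅ = 0 := by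
  simp [cerfH]

open Classical in
/-- **`C̄ ∩ Λ` for the restricted cluster of `x`**: with `C = C_L(x)` the open cluster of `x` in
the configuration restricted to `L` (`siteClusterIn`) and `C̄ = C ∪ ∂ᵒᵘᵗ C` (Cerf 2015, p. 6:
"For `C` an open cluster, we define `C̄ = C ∪ ∂ᵒᵘᵗC`"), the finite set `C̄ ∩ Λ` of the sites of
`Λ` lying in `C` or adjacent to a site of `C` (Prop. 4.1: `C̄(x) ∩ Λ(n)` with `L = Λ(n+ℓ)`).
Empty if `x` is closed or `x ∉ L`. [cite: Cerf2015, §3–§4] -/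
def clusterClosureIn (G : SimpleGraph V) (L Λ : Finset V) (ω : SiteConfig V) (x : V) : Finset V :=
  Λ.filter fun y => y ∈ siteClusterIn G ↑L ω x ∨ ∃ z ∈ siteClusterIn G ↑L ω x, G.Adj z y

open Classical in
/-- Membership in `C̄_L(x) ∩ Λ`. [cite: Cerf2015, §3–§4] -/
theorem mem_clusterClosureIn_iff {G : SimpleGraph V} {L Λ : Finset V} {ω : SiteConfig V}
    {x y : V} : y ∈ clusterClosureIn G L Λ ω x ↔
      y ∈ Λ ∧ (y ∈ siteClusterIn G ↑L ω x ∨ ∃ z ∈ siteClusterIn G ↑L ω x, G.Adj z y) := by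
  simp [clusterClosureIn]

/-- If `x` is closed its restricted cluster is empty, hence so is `C̄_L(x) ∩ Λ`.
[cite: Cerf2015, §3–§4] -/
theorem clusterClosureIn_eq_empty {G : SimpleGraph V} {L Λ : Finset V} {ω : SiteConfig V} {x : V}
    (hx : x ∉ ω) : clusterClosureIn G L Λ ω x = ∅ := by
  have hC : siteClusterIn G ↑L ω x = ∅ := by
    ext y
    simp only [mem_siteClusterIn_iff, Set.mem_empty_iff_false, iff_false]
    exact fun h => hx h.1
  ext y
  simp [mem_clusterClosureIn_iff, hC]

open Classical in
/-- **The collection `𝒞`** (Cerf 2015, §2, p. 5, repaired as explained in the module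
docstring): the open clusters of the configuration restricted to `L` which intersect both `Λ`
and `∂ⁱⁿ L`, as a finite family of finite sets of sites (each such cluster is `C_L(x)` for some
`x ∈ Λ`, namely any of its sites in `Λ`). Cerf's `𝒞` for the pair `(n, ℓ)` is
`reachingClusters (zdGraph d) (Λ(n+ℓ)) (Λ(n+1))`. [cite: Cerf2015, §2–§3] -/
def reachingClusters (G : SimpleGraph V) [DecidableEq V] [G.LocallyFinite] (L Λ : Finset V)
    (ω : SiteConfig V) : Finset (Finset V) :=
  (Λ.filter fun x => ∃ w ∈ innerBoundary G L, w ∈ siteClusterIn G ↑L ω x).image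
    fun x => L.filter fun y => y ∈ siteClusterIn G ↑L ω x

open Classical in
/-- Membership in `𝒞`: the members are the finite sets `C_L(x) (= C_L(x) ∩ L)` for `x ∈ Λ` whose
restricted cluster reaches `∂ⁱⁿ L`. [cite: Cerf2015, §2–§3] -/
theorem mem_reachingClusters_iff {G : SimpleGraph V} [DecidableEq V] [G.LocallyFinite]
    {L Λ : Finset V} {ω : SiteConfig V} {C : Finset V} : C ∈ reachingClusters G L Λ ω ↔
      ∃ x ∈ Λ, (∃ w ∈ innerBoundary G L, w ∈ siteClusterIn G ↑L ω x) ∧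
        (L.filter fun y => y ∈ siteClusterIn G ↑L ω x) = C := by
  simp only [reachingClusters, Finset.mem_image, Finset.mem_filter]
  constructor
  · rintro ⟨x, ⟨hx, hw⟩, hC⟩
    exact ⟨x, hx, hw, hC⟩
  · rintro ⟨x, hx, hw, hC⟩
    exact ⟨x, ⟨hx, hw⟩, hC⟩

/-! ### Named facts (Cerf 2015, §§4–9), to be discharged bottom-up -/

/-- **Cerf 2015, Proposition 4.1** (the large deviation estimate; AKN / GGR exploration and
Hoeffding's inequality): "For any `p ∈ ]0,1[`, any `n ≥ 1`, `ℓ ≥ 0`, we have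
`∀ x ∈ Λ(n+ℓ) ∀ k ≥ 1 ∀ t ≥ 0, P(|h(C̄(x) ∩ Λ(n))| ≥ t, |C̄(x) ∩ Λ(n)| = k) ≤
exp(−2p²(1−p)² t²/k)`", where `C(x)` is the open cluster of `x` in the configuration restricted
to `Λ(n+ℓ)`. Vendored with the factor `2` produced by the printed proof (two-sided Hoeffding
bound, p. 7; module docstring). Holds in every dimension. [cite: Cerf2015, Prop 4.1] -/
def Cerf2015_prop_4_1 : Prop :=
  ∀ d : ℕ, ∀ p : unitInterval, 0 < (p : ℝ) → (p : ℝ) < 1 → ∀ n ℓ : ℕ, 1 ≤ n →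
    ∀ x ∈ box d (n + ℓ), ∀ k : ℕ, 1 ≤ k → ∀ t : ℝ, 0 ≤ t →
      (sitePercolation (Site d) p).real
          {ω | t ≤ |cerfH p ω (clusterClosureIn (zdGraph d) (box d (n + ℓ)) (box d n) ω x)| ∧
            (clusterClosureIn (zdGraph d) (box d (n + ℓ)) (box d n) ω x).card = k} ≤
        2 * Real.exp (-2 * (p : ℝ) ^ 2 * (1 - p) ^ 2 * t ^ 2 / k)

/-- **Cerf 2015, Lemma 5.1** (the central inequality): "For any `p ∈ ]0,1[`, any `n ≥ 1`,
`ℓ ≥ 0`, `P(two-arms(0, 2n+ℓ)) ≤ (2d ln n/√|Λ(n)|) E(√|𝒞|) +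
(4d/(p(1−p))) |Λ(n)|² exp(−2 (ln n)² p² (1−p)²)`." Vendored for the repaired collection
`𝒞 = reachingClusters (zdGraph d) Λ(n+ℓ) Λ(n+1)` (clusters of `Λ(n+ℓ)` meeting `Λ(n+1)` and
`∂ⁱⁿΛ(n+ℓ)`), for `ℓ ≥ 2`, and with `|Λ(n+1)|²` in the second term (module docstring: this is
what the printed proof establishes). [cite: Cerf2015, Lem 5.1] -/
def Cerf2015_lem_5_1 : Prop :=
  ∀ d : ℕ, 2 ≤ d → ∀ p : unitInterval, 0 < (p : ℝ) → (p : ℝ) < 1 → ∀ n ℓ : ℕ, 1 ≤ n → 2 ≤ ℓ →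
    (sitePercolation (Site d) p).real (siteTwoArms d 0 (2 * n + ℓ)) ≤
      2 * d * Real.log n / Real.sqrt ((box d n).card : ℝ) *
          ∫ ω, Real.sqrt ((reachingClusters (zdGraph d) (box d (n + ℓ)) (box d (n + 1)) ω).card : ℝ)
            ∂(sitePercolation (Site d) p) +
        4 * d / ((p : ℝ) * (1 - p)) * ((box d (n + 1)).card : ℝ) ^ 2 *
          Real.exp (-2 * Real.log n ^ 2 * (p : ℝ) ^ 2 * (1 - p) ^ 2)

/-- **Cerf 2015, Lemma 6.1 in the form used in §10** (connection lower bound at a parameter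
`p` with `θ(p) > 0`): "There exists a positive constant `c` [here depending on `d` and `θ(p)`]
such that, for `n ≥ 1`, `∀ x, y ∈ Λ(n)`, `P_p(x ⟷ y in Λ(2n)) ≥ c/n^{2(d−1)d}`." Printed at
`p_c` with `c = c(d)`; at `p` with `θ(p) > 0` the printed proof goes through with the input
`P_p(0 ⟷ x_n in Λ(n)) ≥ θ(p)/|∂ⁱⁿΛ(n)|` of p. 15 (module docstring).
[cite: Cerf2015, Lem 6.1 and §10 p. 15] -/
def Cerf2015_lem_6_1_of_siteTheta_pos : Prop :=
  ∀ d : ℕ, 2 ≤ d → ∀ p : unitInterval, 0 < siteTheta (zdGraph d) 0 p →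
    ∃ c : ℝ, 0 < c ∧ ∀ n : ℕ, 1 ≤ n → ∀ x ∈ box d n, ∀ y ∈ box d n,
      c / (n : ℝ) ^ (2 * (d - 1) * d) ≤
        (sitePercolation (Site d) p).real (siteConnIn (zdGraph d) ↑(box d (2 * n)) x y)

/-- **Cerf 2015, the recursive inequality of §8–§9** (p. 13, last display, combined with the
connection lower bound as in the first display of §9, p. 14, here at a parameter `p` with
`θ(p) > 0`, `p < 1`): there is `c = c(d, p)` such that for `n ≥ 2` and `1 ≤ k ≤ n − 3`,
`P(two-arms(0, 3n)) ≤ (c ln n/√n) (k^{−(d−1)} + k^{2d²+2d−2} P(two-arms(0, n−k−2)))^{1/2}`.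
Printed with `two-arms(0, n−k)` and "`1 ≤ k ≤ n`"; see the module docstring for the range and
the radius (the vendored form is implied by the printed one, `m ↦ two-arms(0,m)` being
decreasing, and is what the printed proof yields). Inputs of the printed proof: Lemma 5.1 with
`ℓ = n`, the covering of `∂ⁱⁿΛ(n+1)` by `≤ 2d(2n/k)^{d−1}` translates of `Λ(k)`, Cor. 7.2,
Lemma 6.1 (`θ(p) > 0` form) and `E(√|𝒞|) ≤ E(|𝒞|)^{1/2}`. [cite: Cerf2015, §8–§9 (p. 13–14)] -/
def Cerf2015_sec9_recursion : Prop :=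
  ∀ d : ℕ, 2 ≤ d → ∀ p : unitInterval, 0 < siteTheta (zdGraph d) 0 p → (p : ℝ) < 1 →
    ∃ c : ℝ, ∀ n k : ℕ, 2 ≤ n → 1 ≤ k → k + 3 ≤ n →
      (sitePercolation (Site d) p).real (siteTwoArms d 0 (3 * n)) ≤
        c * Real.log n / Real.sqrt n *
          Real.sqrt (1 / (k : ℝ) ^ (d - 1) + (k : ℝ) ^ (2 * d ^ 2 + 2 * d - 2) *
            (sitePercolation (Site d) p).real (siteTwoArms d 0 (n - k - 2)))

end CritPerc

end Literature.Probability.Percolation
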